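import Literature.MathematicalPhysics.QuantumFieldTheory.Balaban1983to89.T4PinnedGasOfGeometry

/-!
# T4PeierlsDomination — the PEIERLS FORM of the relative-weight extraction R3 of node U5c: a KP-free pinned-class bound
and a gas-free domination shape for the persistent-activity weight bound NE7b (cell `pub-balaban`, T4-DAG v4 §2 U5c /
row T4-U5.E-a; bookkeeping, self-proposed kernel sub-row T4-U5.E-a-PF)

HONEST FRAMING (cell `pub-balaban`, T4-DAG PAGE 1).  The cell's T4 target is the existence AND uniqueness of the
continuum limit of Bałaban's unit-scale averaged loop expectations on a FIXED finite torus — strictly beyond ultraviolet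
stability ([Balaban1989LargeFieldII] Thm 1 p. 355); it is NOT the Yang–Mills mass gap and NOT the Clay problem.  Nothing
in this module is an estimate of Bałaban's expansion: it is finite combinatorics on hypothesis SHAPES of the cell's own
uniqueness spine (node U5c, `T4WeightBudget` / `T4WeightBudgetKP`), stated so that the estimate seat of row T4-U5.E-a has a
thinner target.  No quotation of the papers is added; nothing of [Balaban1989LargeFieldII] is cited as stating anything
below.

THE POINT.  Node U5c's relative-weight extraction was split (rows T4-U5c.E-KP / T4-U5c.E-KP2, `T4WeightBudgetKP`) into
R3a = the pinned-class bound of a Kotecký–Preiss polymer gas (`PinnedGas.bad_le_of_kp`: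
`bad ≤ (1 − e^{−pinnedSize}) · total` under `PinnedGas.IsKP`) and R3b = the representation / DOMINATION of each run's
positive history weights by such a gas (`PolymerRep`, `PolymerDom`), the latter carrying the two recorded failure modes of
row U5.E-a: (F1) "domination must survive the ℝ-exponentiation between scales" and (F2) "signed activities at real t"
(a positive pinned-gas domination needs absolute values of Mayer activities).  Both failure modes come from routing R3
through a polymer GAS.  This module records that the gas — and the Kotecký–Preiss condition — are not needed for the
weight slot:

§1 KP-FREE R3a.  For the non-negative real gases of `T4WeightBudgetKP.PinnedGas`, deletion-positivity alone gives
   `Z(Λ′ ∪ E) ≤ ∏_{γ ∈ E} (1 + x γ) · Z(Λ′)` (`pinnedGas_Z_union_le`, induction on `E` with the tree's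
   `polymerPartitionFunction_insert` and `re_polymerPartitionFunction_mono`), hence
   `total ≤ ∏_{γ ∈ D}(1 + x γ) · good` and the pinned-class bound `bad ≤ (1 − exp(−Σ_{γ ∈ D} x γ)) · total`
   (`pinnedGas_bad_le_noKP`) with NO Kotecký–Preiss condition and without the `e^{a}` of `pinnedSize`
   (`Σ_{D} x ≤ pinnedSize` when `a ≥ 0` on `D`, `pinnedGas_sum_x_le_pinnedSize`).  Consequently the `IsKP` conjunct of
   `PolymerDom.dom` is not needed by `PolymerDom.bad_le` / `relWeightBound_of_polymerDom`: `PosDom` (§3) is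
   `PolymerDom` with `IsKP` dropped and `pinnedSize ≤ S K` weakened to `Σ_{D} x ≤ S K`, `PolymerDom → PosDom`
   (`PolymerDom.toPosDom`), and `PosDom` feeds the same weight slot (`relWeightBound_of_posDom`).  For the geometry
   liaison `T4PinnedGasOfGeometry` this removes the smallness hypothesis `A e^{τ c₀} K₀ ν ≤ τ` from
   `bad_geomGas_le_of_anchor` (`bad_geomGas_le_of_anchor_noKP`).  The KP condition keeps its role where LOWER bounds
   on ratios of partition functions with SIGNED or complex activities, zero-freeness, or `log Z` additivity are needed
   — the convergent expansion (1.98) p. 390 (module `B16Exp198`: `norm_locR_le`, `eq198_of_ineq197`; node O3), not the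
   U5c weight slot.
§2 GAS-FREE PEIERLS SHAPE.  On a run's OWN finite term family: an ERASURE map `Bad → T ∖ Bad` (or into any dominating
   auxiliary family — the majorant form `sum_le_of_fibre_dom`) and a CHARGE `τ ↦ Q(τ)` (a nonempty set of slots) with
   the FIBRE DOMINATION `Σ_{τ ∈ Bad : erase τ = τ′, charge τ = Q} A τ ≤ A τ′ · ∏_{σ ∈ Q} x σ` give
   `Σ_{Bad} A ≤ (∏_{Slots}(1 + x) − 1) · Σ_{T ∖ Bad} A ≤ (1 − exp(−Σ_{Slots} x)) · Σ_{T} A`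
   (`sum_bad_le_weight_mul_total`; kernel: `Finset.sum_fiberwise_of_maps_to` + `Finset.prod_one_add`).  No product
   structure, no hard-core gas, no Mayer expansion, no convergence condition: (F1) and (F2) do not arise.
§3 THE U5 SHAPES.  `PeierlsDom l₀ T A Bad S` (slots `Fin n`, per `(K, t)`), `PeierlsDom.bad_le`,
   `relWeightBound_of_peierlsDom` and `cauchySum_of_crossover_peierlsDom` — the same weights `1 − e^{−S K}` and the same
   slot `S K / vol` as `relWeightBound_of_polymerDom` / `cauchySum_of_crossover_polymerDom`; and the KP-free gas shape
   `PosDom` with `PolymerDom.toPosDom`, `PosDom.bad_le`, `relWeightBound_of_posDom`.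
§4 A two-term toy `peierlsDom_toy` (the toy of `polymerDom_toy` with the sharper slot `x` in place of `x e^{a}`).

WHAT THIS LEAVES LOCATED FOR ROW T4-U5.E-a (unchanged in substance, thinner in form; NOT claimed here).  With
`PeierlsDom` as target the estimate seat owes, per run and per `(K, t)`: (P-i) an erasure of the old pending
large-field structures of a bad history landing in a GOOD history of the same run (or in a dominating auxiliary family,
majorant form); (P-ii) the FIBRE DOMINATION — the total weight of the bad histories erasing to `τ′` with charge `Q` is at
most `A τ′ · ∏_{σ ∈ Q} x σ`: this is where the inductive bounds (1.79)–(1.89), pp. 384–388 of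
[Balaban1989LargeFieldII] (banked small factors per large-field cube per renewal epoch; `t4/T4-EST-U5c.md` §3 (R1),
(R2), (R4)) must be spent, AND where the soft coupling of a structure to the rest of the expansion (small-field action
near it, ℝ-operations, boundary terms) must be controlled — the honest core of NE7b, exactly as before; (P-iii) the slot
budget `Σ x ≤ S K` with `Σ_K S K < ∞` (renewal cost against positional entropy; `t4/T4-EST-U5c.md` §3 (R4), (R5)).
Whether Bałaban's printed bounds deliver (P-ii) in the sharp form (same family) or only in the majorant form is for that
seat to decide; both are typed here.

Sources.  [Balaban1989LargeFieldII] T. Bałaban, *Large field renormalization. II*, Commun. Math. Phys. **122** (1989)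
355–392 — CONTEXT ONLY (the node this bookkeeping serves); [KoteckyPreiss1986] R. Kotecký, D. Preiss, Commun. Math.
Phys. **103** (1986) 491–498 — CONTEXT ONLY (the condition shown to be unnecessary for R3a).  Everything below is
elementary finite combinatorics and real analysis. [folklore]
-/

noncomputable section

open Finset
open _root_.Literature.Probability.LatticeModels

namespace Literature.MathematicalPhysics.QuantumFieldTheory.Balaban1983to89.T4PeierlsDomination

open Literature.MathematicalPhysics.QuantumFieldTheory.Balaban1983to89.B13FamilySum
open Literature.MathematicalPhysics.QuantumFieldTheory.Balaban1983to89.T4HybridMatching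
open Literature.MathematicalPhysics.QuantumFieldTheory.Balaban1983to89.T4CauchySum
open Literature.MathematicalPhysics.QuantumFieldTheory.Balaban1983to89.T4Crossover
open Literature.MathematicalPhysics.QuantumFieldTheory.Balaban1983to89.T4WeightBudget
open Literature.MathematicalPhysics.QuantumFieldTheory.Balaban1983to89.T4WeightBudgetKP
open Literature.MathematicalPhysics.QuantumFieldTheory.Balaban1983to89.T4PinnedGasOfGeometry
open Literature.MathematicalPhysics.QuantumFieldTheory.Balaban1983to89.B16Exp198

/-! ## §0 Two real-analysis one-liners (`∏ (1 + x) ≤ exp(Σ x)` is the tree's `B13FamilySum.prod_one_add_le_exp_sum`) -/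

/-- The weight-slot algebra: `b ≤ (eˢ − 1) · g` implies `b ≤ (1 − e^{−s}) · (g + b)`. [folklore] -/
theorem le_weight_mul_add {b g s : ℝ} (h : b ≤ (Real.exp s - 1) * g) : b ≤ (1 - Real.exp (-s)) * (g + b) := by
  have hpos : 0 < Real.exp (-s) := Real.exp_pos _
  have hone : Real.exp (-s) * Real.exp s = 1 := by rw [← Real.exp_add]; simp
  have h1 : Real.exp (-s) * b ≤ Real.exp (-s) * ((Real.exp s - 1) * g) := mul_le_mul_of_nonneg_left h hpos.le
  have h2 : Real.exp (-s) * ((Real.exp s - 1) * g) = (1 - Real.exp (-s)) * g := by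
    calc Real.exp (-s) * ((Real.exp s - 1) * g) = (Real.exp (-s) * Real.exp s) * g - Real.exp (-s) * g := by ring
      _ = (1 - Real.exp (-s)) * g := by rw [hone]; ring
  rw [h2] at h1
  linarith

/-- Monotonicity of the weight `1 − e^{−s}` in `s`. [folklore] -/
theorem weight_mono {s S : ℝ} (h : s ≤ S) : 1 - Real.exp (-s) ≤ 1 - Real.exp (-S) :=
  sub_le_sub_left (Real.exp_le_exp.2 (neg_le_neg h)) 1

/-! ## §1 KP-FREE R3a: the pinned class of a non-negative hard-core gas by deletion-positivity -/

/-- **DELETION-POSITIVITY**: adjoining polymers `E` to a volume multiplies the (real, `≥ 1`) partition function of a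
non-negative hard-core gas by at most `∏_{γ ∈ E} (1 + x γ)` — from `Z(insert γ Λ) = Z(Λ) + x γ · Z({γ′ ∈ Λ | ¬ inc γ γ′})`
(tree `polymerPartitionFunction_insert`) and `Z({…}) ≤ Z(Λ)` (tree `re_polymerPartitionFunction_mono`).  No
Kotecký–Preiss condition. [folklore] -/
theorem pinnedGas_Z_union_le (G : PinnedGas) (Λ' E : Finset G.P) :
    G.Z (Λ' ∪ E) ≤ (∏ γ ∈ E, (1 + G.x γ)) * G.Z Λ' := by
  induction E using Finset.induction_on with
  | empty => simp
  | insert γ₀ E hγ₀E ih =>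
    rw [Finset.prod_insert hγ₀E]
    have hx₀ : 0 ≤ G.x γ₀ := G.x_nonneg γ₀
    have hfac : 0 ≤ (∏ γ ∈ E, (1 + G.x γ)) * G.Z Λ' :=
      mul_nonneg (Finset.prod_nonneg fun γ _ => by linarith [G.x_nonneg γ]) (G.Z_pos Λ').le
    by_cases hmem : γ₀ ∈ Λ' ∪ E
    · have hset : Λ' ∪ insert γ₀ E = Λ' ∪ E := by
        rw [Finset.union_insert, Finset.insert_eq_of_mem hmem]
      rw [hset]
      calc G.Z (Λ' ∪ E) ≤ (∏ γ ∈ E, (1 + G.x γ)) * G.Z Λ' := ih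
        _ ≤ (1 + G.x γ₀) * ((∏ γ ∈ E, (1 + G.x γ)) * G.Z Λ') := le_mul_of_one_le_left hfac (by linarith)
        _ = (1 + G.x γ₀) * (∏ γ ∈ E, (1 + G.x γ)) * G.Z Λ' := by ring
    · rw [Finset.union_insert]
      have hre : G.Z (insert γ₀ (Λ' ∪ E)) =
          G.Z (Λ' ∪ E) + G.x γ₀ * G.Z ((Λ' ∪ E).filter fun γ' => ¬ G.inc γ₀ γ') := by
        simp only [PinnedGas.Z]
        rw [polymerPartitionFunction_insert inc_symm_of_symm G.w hmem, Complex.add_re]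
        simp [PinnedGas.w]
      have hmono : G.Z ((Λ' ∪ E).filter fun γ' => ¬ G.inc γ₀ γ') ≤ G.Z (Λ' ∪ E) :=
        re_polymerPartitionFunction_mono G.w_im G.w_re_nonneg (Finset.filter_subset _ _)
      calc G.Z (insert γ₀ (Λ' ∪ E))
          = G.Z (Λ' ∪ E) + G.x γ₀ * G.Z ((Λ' ∪ E).filter fun γ' => ¬ G.inc γ₀ γ') := hre
        _ ≤ G.Z (Λ' ∪ E) + G.x γ₀ * G.Z (Λ' ∪ E) := by
            have := mul_le_mul_of_nonneg_left hmono hx₀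
            linarith
        _ = (1 + G.x γ₀) * G.Z (Λ' ∪ E) := by ring
        _ ≤ (1 + G.x γ₀) * ((∏ γ ∈ E, (1 + G.x γ)) * G.Z Λ') := mul_le_mul_of_nonneg_left ih (by linarith)
        _ = (1 + G.x γ₀) * (∏ γ ∈ E, (1 + G.x γ)) * G.Z Λ' := by ring

/-- `total ≤ ∏_{γ ∈ D} (1 + x γ) · good` — KP-free. [folklore] -/
theorem pinnedGas_total_le_prod_mul_good (G : PinnedGas) : G.total ≤ (∏ γ ∈ G.D, (1 + G.x γ)) * G.good := by
  have h := pinnedGas_Z_union_le G (G.Λ \ G.D) G.D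
  rw [Finset.sdiff_union_of_subset G.D_subset] at h
  exact h

/-- **KP-FREE R3a — the pinned-class bound by positivity alone**: for every pinned gas with non-negative activities,
`bad ≤ (1 − exp(−Σ_{γ ∈ D} x γ)) · total`.  Compare `PinnedGas.bad_le_of_kp` (same conclusion with the larger
`pinnedSize = Σ_{D} x e^{a}` and the hypothesis `IsKP`). [folklore] -/
theorem pinnedGas_bad_le_noKP (G : PinnedGas) : G.bad ≤ (1 - Real.exp (-∑ γ ∈ G.D, G.x γ)) * G.total := by
  have h1 := pinnedGas_total_le_prod_mul_good G
  have h2 := prod_one_add_le_exp_sum G.D G.x fun γ _ => G.x_nonneg γ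
  have hg : 0 ≤ G.good := (G.Z_pos _).le
  have hb : G.bad ≤ (Real.exp (∑ γ ∈ G.D, G.x γ) - 1) * G.good := by
    have : G.total ≤ Real.exp (∑ γ ∈ G.D, G.x γ) * G.good := h1.trans (mul_le_mul_of_nonneg_right h2 hg)
    simp only [PinnedGas.bad]
    linarith
  have h3 := le_weight_mul_add hb
  have hsum : G.good + G.bad = G.total := by simp only [PinnedGas.bad]; ring
  rwa [hsum] at h3

/-- Monotone form: `Σ_{D} x ≤ S ⇒ bad ≤ (1 − e^{−S}) · total` — `PinnedGas.bad_le_of_kp_of_le` without `IsKP`.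
[folklore] -/
theorem pinnedGas_bad_le_of_sum_le (G : PinnedGas) {S : ℝ} (hS : ∑ γ ∈ G.D, G.x γ ≤ S) :
    G.bad ≤ (1 - Real.exp (-S)) * G.total :=
  (pinnedGas_bad_le_noKP G).trans (mul_le_mul_of_nonneg_right (weight_mono hS) G.total_pos.le)

/-- The linear pinned size dominates: `Σ_{γ ∈ D} x γ ≤ pinnedSize` when the size function is `≥ 0` on `D`. [folklore] -/
theorem pinnedGas_sum_x_le_pinnedSize (G : PinnedGas) (ha : ∀ γ ∈ G.D, 0 ≤ G.a γ) :
    ∑ γ ∈ G.D, G.x γ ≤ G.pinnedSize := by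
  refine Finset.sum_le_sum fun γ hγ => ?_
  have hn : ‖G.w γ‖ = G.x γ := by
    simp [PinnedGas.w, Complex.norm_real, Real.norm_eq_abs, abs_of_nonneg (G.x_nonneg γ)]
  rw [kpTerm, hn]
  exact le_mul_of_one_le_right (G.x_nonneg γ) (Real.one_le_exp (ha γ hγ))

/-- Under `IsKP` the size function is `≥ 0` on the volume (a sum of non-negative `kpTerm`s is `≤ a γ`). [folklore] -/
theorem pinnedGas_a_nonneg_of_isKP (G : PinnedGas) (hKP : G.IsKP) : ∀ γ ∈ G.Λ, 0 ≤ G.a γ := by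
  intro γ hγ
  have h : ∑ γ' ∈ G.Λ with G.inc γ' γ, kpTerm G.w G.a γ' ≤ G.a γ := hKP γ hγ
  exact (Finset.sum_nonneg fun γ' _ => kpTerm_nonneg _ _ γ').trans h

/-- `PinnedGas.bad_le_of_kp_of_le` with `IsKP` replaced by `a ≥ 0` on `D`. [folklore] -/
theorem pinnedGas_bad_le_of_pinnedSize_le (G : PinnedGas) (ha : ∀ γ ∈ G.D, 0 ≤ G.a γ) {S : ℝ}
    (hS : G.pinnedSize ≤ S) : G.bad ≤ (1 - Real.exp (-S)) * G.total :=
  pinnedGas_bad_le_of_sum_le G ((pinnedGas_sum_x_le_pinnedSize G ha).trans hS)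

section Geometry

variable {S : B16.RelDomainSys} {Cube : Type} [DecidableEq Cube] (G : Geometry S Cube)

/-- **The anchored-class bound of `T4PinnedGasOfGeometry` WITHOUT the KP smallness** `A e^{τ c₀} K₀ ν ≤ τ`: under the
(1.97)-shape decay on the catalogue and `κ₀ + τ c₀ ≤ R` only, the compatible families of (1.90)-polymers containing a
polymer of a class anchored at one cube `q ∉ Yfix` have relative weight `bad ≤ (1 − exp(−A e^{τ c₀} K₀)) · total`.
[folklore] -/
theorem bad_geomGas_le_of_anchor_noKP {x : S.Dom → ℝ} (hx : ∀ Z, 0 ≤ x Z) {τ A R : ℝ} (hτ : 0 ≤ τ) (hA : 0 ≤ A)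
    (hxA : ∀ Z ∈ G.adm, x Z ≤ A * Real.exp (-(R * S.dRel Z))) (hrate : G.κ₀ + τ * G.c₀ ≤ R)
    {D : Finset S.Dom} (hD : D ⊆ G.adm) {q : Cube} (hq : ∀ Z ∈ D, q ∈ G.cubes Z \ G.Yfix) :
    (geomGas G x hx τ D hD).bad ≤
      (1 - Real.exp (-(A * Real.exp (τ * G.c₀) * G.K₀))) * (geomGas G x hx τ D hD).total :=
  pinnedGas_bad_le_of_pinnedSize_le _
    (fun Z _ => by rw [geomGas_a]; exact mul_nonneg hτ (Nat.cast_nonneg _))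
    (pinnedSize_geomGas_le_of_anchor G hx hτ hA hxA hrate hD hq)

end Geometry

/-! ## §2 THE GAS-FREE PEIERLS BOUND on a finite term family -/

/-- **FIBRE-DOMINATION ⇒ PEIERLS BOUND (majorant form).**  Terms `Bad` with weights `A`, an auxiliary family `Good`
with weights `A′`, slots `Slots` with activities `x`; an erasure `Bad → Good` and a charge `τ ↦ Q(τ) ⊆ Slots`, `Q(τ) ≠ ∅`.
If for every `τ′ ∈ Good` and every `Q ⊆ Slots` the fibre is dominated,
`Σ_{τ ∈ Bad : erase τ = τ′ ∧ charge τ = Q} A τ ≤ A′ τ′ · ∏_{σ ∈ Q} x σ`, then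
`Σ_{Bad} A ≤ (∏_{σ ∈ Slots} (1 + x σ) − 1) · Σ_{Good} A′`.  (The "+1 −1" resummation over nonempty slot sets:
`Finset.prod_one_add`.)  No sign hypothesis is needed at this stage. [folklore] -/
theorem sum_le_of_fibre_dom {ι κ σ : Type*} [DecidableEq κ] [DecidableEq σ] (Bad : Finset ι) (Good : Finset κ)
    (Slots : Finset σ) (A : ι → ℝ) (A' : κ → ℝ) (x : σ → ℝ) (erase : ι → κ) (charge : ι → Finset σ)
    (herase : ∀ τ ∈ Bad, erase τ ∈ Good) (hcharge : ∀ τ ∈ Bad, charge τ ⊆ Slots ∧ (charge τ).Nonempty)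
    (hdom : ∀ τ' ∈ Good, ∀ Q ∈ Slots.powerset,
      ∑ τ ∈ Bad with (erase τ = τ' ∧ charge τ = Q), A τ ≤ A' τ' * ∏ s ∈ Q, x s) :
    ∑ τ ∈ Bad, A τ ≤ ((∏ s ∈ Slots, (1 + x s)) - 1) * ∑ τ' ∈ Good, A' τ' := by
  have hmaps : ∀ τ ∈ Bad, (erase τ, charge τ) ∈ Good ×ˢ (Slots.powerset.erase ∅) := fun τ hτ =>
    Finset.mem_product.2 ⟨herase τ hτ,
      Finset.mem_erase.2 ⟨(hcharge τ hτ).2.ne_empty, Finset.mem_powerset.2 (hcharge τ hτ).1⟩⟩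
  have hfib : ∑ τ ∈ Bad, A τ =
      ∑ p ∈ Good ×ˢ (Slots.powerset.erase ∅), ∑ τ ∈ Bad with (erase τ, charge τ) = p, A τ :=
    (Finset.sum_fiberwise_of_maps_to (g := fun τ => (erase τ, charge τ)) hmaps A).symm
  have hdom' : ∀ τ' ∈ Good, ∀ Q ∈ Slots.powerset.erase ∅,
      ∑ τ ∈ Bad with (erase τ, charge τ) = (τ', Q), A τ ≤ A' τ' * ∏ s ∈ Q, x s := by
    intro τ' hτ' Q hQ
    have hset : (Bad.filter fun τ => (erase τ, charge τ) = (τ', Q)) =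
        Bad.filter fun τ => erase τ = τ' ∧ charge τ = Q :=
      Finset.filter_congr fun τ _ => by simp only [Prod.mk.injEq]
    rw [hset]
    exact hdom τ' hτ' Q (Finset.mem_of_mem_erase hQ)
  rw [hfib, Finset.sum_product]
  calc ∑ τ' ∈ Good, ∑ Q ∈ Slots.powerset.erase ∅, ∑ τ ∈ Bad with (erase τ, charge τ) = (τ', Q), A τ
      ≤ ∑ τ' ∈ Good, ∑ Q ∈ Slots.powerset.erase ∅, A' τ' * ∏ s ∈ Q, x s :=
        Finset.sum_le_sum fun τ' hτ' => Finset.sum_le_sum fun Q hQ => hdom' τ' hτ' Q hQ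
    _ = (∑ Q ∈ Slots.powerset.erase ∅, ∏ s ∈ Q, x s) * ∑ τ' ∈ Good, A' τ' := by
        rw [Finset.sum_comm, Finset.sum_mul]
        exact Finset.sum_congr rfl fun Q _ => by rw [← Finset.sum_mul]; exact mul_comm _ _
    _ = ((∏ s ∈ Slots, (1 + x s)) - 1) * ∑ τ' ∈ Good, A' τ' := by
        rw [Finset.sum_erase_eq_sub (Finset.empty_mem_powerset _), Finset.prod_empty, Finset.prod_one_add]

/-- **THE PEIERLS BOUND (sharp, same-family form).**  If the erasure lands in the GOOD class `T ∖ Bad` of the same family,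
all weights on `T` are `≥ 0` and the slot activities are `≥ 0`, then
`Σ_{Bad} A ≤ (1 − exp(−Σ_{Slots} x)) · Σ_{T} A` — EXACTLY the per-run clause of `T4WeightBudget.RelWeightBound` with the
weight `1 − e^{−S}`, `S = Σ_{Slots} x`, the same slot as `relWeightBound_of_polymerDom`.  No polymer gas, no
Kotecký–Preiss condition, no Mayer expansion. [folklore] -/
theorem sum_bad_le_weight_mul_total {ι σ : Type*} [DecidableEq ι] [DecidableEq σ] {T Bad : Finset ι}
    {Slots : Finset σ} {A : ι → ℝ} {x : σ → ℝ} (erase : ι → ι) (charge : ι → Finset σ) (hBT : Bad ⊆ T)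
    (hA : ∀ τ ∈ T, 0 ≤ A τ) (hx : ∀ s ∈ Slots, 0 ≤ x s) (herase : ∀ τ ∈ Bad, erase τ ∈ T \ Bad)
    (hcharge : ∀ τ ∈ Bad, charge τ ⊆ Slots ∧ (charge τ).Nonempty)
    (hdom : ∀ τ' ∈ T \ Bad, ∀ Q ∈ Slots.powerset,
      ∑ τ ∈ Bad with (erase τ = τ' ∧ charge τ = Q), A τ ≤ A τ' * ∏ s ∈ Q, x s) :
    ∑ τ ∈ Bad, A τ ≤ (1 - Real.exp (-∑ s ∈ Slots, x s)) * ∑ τ ∈ T, A τ := by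
  have h1 := sum_le_of_fibre_dom Bad (T \ Bad) Slots A A x erase charge herase hcharge hdom
  have hg : 0 ≤ ∑ τ ∈ T \ Bad, A τ := Finset.sum_nonneg fun τ hτ => hA τ (Finset.mem_sdiff.1 hτ).1
  have h2 : ∑ τ ∈ Bad, A τ ≤ (Real.exp (∑ s ∈ Slots, x s) - 1) * ∑ τ ∈ T \ Bad, A τ :=
    h1.trans (mul_le_mul_of_nonneg_right (sub_le_sub_right (prod_one_add_le_exp_sum Slots x hx) 1) hg)
  have h3 := le_weight_mul_add h2
  rwa [Finset.sum_sdiff hBT] at h3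

/-! ## §3 THE U5 SHAPES: `PeierlsDom` (gas-free) and `PosDom` (KP-free gas), both feeding `RelWeightBound` -/

/-- **R3 IN PEIERLS FORM (HYPOTHESIS SHAPE, NOT PRINTED, NOT ASSERTED).**  At each fixed `(K, t)`, `|t| ≤ l₀`: finitely
many slots (`Fin n`) with activities `x ≥ 0` of total `≤ S K`, an erasure sending each bad term to a GOOD term of the
same run, and a nonempty charge, with the fibre domination
`Σ_{τ ∈ Bad K t : erase τ = τ′ ∧ charge τ = Q} A K t τ ≤ A K t τ′ · ∏_{i ∈ Q} x i` for every good `τ′` and every slot set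
`Q`.  In the application: slots = (creation scale, position/shape) of an old pending large-field structure, erasure =
the same history with those structures taken on their small-field branch, `x` = the banked cost of a structure along a
history branch (renewals within `≤ N′` steps) INCLUDING its coupling to the rest.  HYPOTHESIS SHAPE ONLY; nothing of
[Balaban1989LargeFieldII] is cited as stating it. [folklore] -/
structure PeierlsDom {ι : Type*} [DecidableEq ι] (l₀ : ℝ) (T : ℕ → Finset ι) (A : ℕ → ℝ → ι → ℝ)
    (Bad : ℕ → ℝ → Finset ι) (S : ℕ → ℝ) : Prop where
  /-- the bad class consists of terms -/
  bad_subset : ∀ K t, |t| ≤ l₀ → Bad K t ⊆ T K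
  /-- erasure + charge with fibre domination and slot budget `≤ S K` -/
  dom : ∀ K t, |t| ≤ l₀ → ∃ (n : ℕ) (x : Fin n → ℝ) (erase : ι → ι) (charge : ι → Finset (Fin n)),
    (∀ i, 0 ≤ x i) ∧ ∑ i, x i ≤ S K ∧
    (∀ τ ∈ Bad K t, erase τ ∈ T K \ Bad K t ∧ (charge τ).Nonempty) ∧
    ∀ τ' ∈ T K \ Bad K t, ∀ Q : Finset (Fin n),
      ∑ τ ∈ Bad K t with (erase τ = τ' ∧ charge τ = Q), A K t τ ≤ A K t τ' * ∏ i ∈ Q, x i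

/-- **R3 IN KP-FREE GAS FORM** (`PolymerDom` with the `IsKP` conjunct dropped and the size read linearly): at each
`(K, t)` a pinned gas `G` (non-negative activities, NO convergence condition) and `c ≥ 0` with
`Σ_{Bad} A ≤ c · G.bad`, `c · G.total ≤ Σ_{T} A`, `Σ_{γ ∈ G.D} x γ ≤ S K`.  HYPOTHESIS SHAPE ONLY. [folklore] -/
structure PosDom {ι : Type*} (l₀ : ℝ) (T : ℕ → Finset ι) (A : ℕ → ℝ → ι → ℝ) (Bad : ℕ → ℝ → Finset ι)
    (S : ℕ → ℝ) : Prop where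
  /-- the bad class consists of terms -/
  bad_subset : ∀ K t, |t| ≤ l₀ → Bad K t ⊆ T K
  /-- domination by a non-negative pinned gas at fixed `(K, t)` -/
  dom : ∀ K t, |t| ≤ l₀ → ∃ G : PinnedGas, ∃ c : ℝ, 0 ≤ c ∧
    ∑ τ ∈ Bad K t, A K t τ ≤ c * G.bad ∧ c * G.total ≤ ∑ τ ∈ T K, A K t τ ∧ ∑ γ ∈ G.D, G.x γ ≤ S K

section Shapes

variable {ι : Type*} {l₀ : ℝ} {T : ℕ → Finset ι} {A B : ℕ → ℝ → ι → ℝ} {Bad : ℕ → ℝ → Finset ι} {S : ℕ → ℝ}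

/-- `PolymerDom → PosDom`: the KP condition is used only to read off `a ≥ 0` on the volume, whence
`Σ_{D} x ≤ pinnedSize ≤ S K`. [folklore] -/
theorem PolymerDom.toPosDom (h : PolymerDom l₀ T A Bad S) : PosDom l₀ T A Bad S where
  bad_subset := h.bad_subset
  dom K t ht := by
    obtain ⟨G, c, hc, hKP, hB, hT, hS⟩ := h.dom K t ht
    exact ⟨G, c, hc, hB, hT, (pinnedGas_sum_x_le_pinnedSize G fun γ hγ =>
      pinnedGas_a_nonneg_of_isKP G hKP γ (G.D_subset hγ)).trans hS⟩

/-- One run, KP-free gas form: `Σ_{Bad} A ≤ (1 − e^{−S K}) · Σ_{T} A`. [folklore] -/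
theorem PosDom.bad_le (h : PosDom l₀ T A Bad S) (K : ℕ) (t : ℝ) (ht : |t| ≤ l₀) :
    ∑ τ ∈ Bad K t, A K t τ ≤ (1 - Real.exp (-S K)) * ∑ τ ∈ T K, A K t τ := by
  obtain ⟨G, c, hc, hB, hT, hS⟩ := h.dom K t ht
  have hS0 : 0 ≤ S K := (Finset.sum_nonneg fun γ _ => G.x_nonneg γ).trans hS
  have hW0 : 0 ≤ 1 - Real.exp (-S K) := by
    have : Real.exp (-S K) ≤ 1 := Real.exp_le_one_iff.2 (by linarith)
    linarith
  calc ∑ τ ∈ Bad K t, A K t τ ≤ c * G.bad := hB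
    _ ≤ c * ((1 - Real.exp (-S K)) * G.total) := mul_le_mul_of_nonneg_left (pinnedGas_bad_le_of_sum_le G hS) hc
    _ = (1 - Real.exp (-S K)) * (c * G.total) := by ring
    _ ≤ (1 - Real.exp (-S K)) * ∑ τ ∈ T K, A K t τ := mul_le_mul_of_nonneg_left hT hW0

/-- KP-free gas dominations of both runs ⇒ `RelWeightBound` with weights `1 − e^{−S K}`. [folklore] -/
theorem relWeightBound_of_posDom (hS0 : ∀ K, 0 ≤ S K) (hS : Summable S) (hA : PosDom l₀ T A Bad S)
    (hB : PosDom l₀ T B Bad S) : RelWeightBound l₀ T A B Bad (fun K => 1 - Real.exp (-S K)) where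
  bad_subset := hA.bad_subset
  nonneg K := by have : Real.exp (-S K) ≤ 1 := Real.exp_le_one_iff.2 (by linarith [hS0 K]); linarith
  lt_one K := weightKP_lt_one (S K)
  summable := summable_weightKP hS0 hS
  bad_left K t ht := hA.bad_le K t ht
  bad_right K t ht := hB.bad_le K t ht

variable [DecidableEq ι]

/-- One run, Peierls form: `Σ_{Bad} A ≤ (1 − e^{−S K}) · Σ_{T} A` (from `sum_bad_le_weight_mul_total` with slots
`Fin n`). [folklore] -/
theorem PeierlsDom.bad_le (h : PeierlsDom l₀ T A Bad S) (hA : ∀ K t, |t| ≤ l₀ → ∀ τ ∈ T K, 0 ≤ A K t τ)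
    (K : ℕ) (t : ℝ) (ht : |t| ≤ l₀) :
    ∑ τ ∈ Bad K t, A K t τ ≤ (1 - Real.exp (-S K)) * ∑ τ ∈ T K, A K t τ := by
  obtain ⟨n, x, erase, charge, hx, hxS, hec, hdom⟩ := h.dom K t ht
  have h1 := sum_bad_le_weight_mul_total (Slots := (Finset.univ : Finset (Fin n))) erase charge
    (h.bad_subset K t ht) (hA K t ht) (fun i _ => hx i) (fun τ hτ => (hec τ hτ).1)
    (fun τ hτ => ⟨Finset.subset_univ _, (hec τ hτ).2⟩) (fun τ' hτ' Q _ => hdom τ' hτ' Q)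
  exact h1.trans (mul_le_mul_of_nonneg_right (weight_mono hxS) (Finset.sum_nonneg (hA K t ht)))

/-- **THE LIAISON IN PEIERLS FORM (gas-free R3 ⇒ NE7b's output shape).**  Peierls dominations of both runs with a common
slot budget `S ≥ 0`, `Σ_K S K < ∞`, and non-negative term weights give
`RelWeightBound l₀ T A B Bad (fun K ↦ 1 − exp(−S K))` — the instantiation target of row T4-U5.E-a in its thinnest form.
[folklore] -/
theorem relWeightBound_of_peierlsDom (hS0 : ∀ K, 0 ≤ S K) (hS : Summable S)
    (hA : ∀ K t, |t| ≤ l₀ → ∀ τ ∈ T K, 0 ≤ A K t τ) (hB : ∀ K t, |t| ≤ l₀ → ∀ τ ∈ T K, 0 ≤ B K t τ)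
    (hPA : PeierlsDom l₀ T A Bad S) (hPB : PeierlsDom l₀ T B Bad S) :
    RelWeightBound l₀ T A B Bad (fun K => 1 - Real.exp (-S K)) where
  bad_subset := hPA.bad_subset
  nonneg K := by have : Real.exp (-S K) ≤ 1 := Real.exp_le_one_iff.2 (by linarith [hS0 K]); linarith
  lt_one K := weightKP_lt_one (S K)
  summable := summable_weightKP hS0 hS
  bad_left K t ht := hPA.bad_le hA K t ht
  bad_right K t ht := hPB.bad_le hB K t ht

variable {vol : ℝ}

/-- **The analytic end of the uniqueness spine with NE7b discharged down to the PEIERLS FORM of R3** (=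
`T4WeightBudget.cauchySum_of_crossover_relWeightBound` ∘ `relWeightBound_of_peierlsDom`, slot rewritten by
`weightSlot_fun_eq`): binder-for-binder `cauchySum_of_crossover_polymerDom` with `PeierlsDom` in place of `PolymerDom`.
Every named estimate is a hypothesis. [folklore] -/
theorem cauchySum_of_crossover_peierlsDom {E a θ Λ b β' R₁ C : ℝ} {κ₀ : ℕ} {g : ℕ → ℝ} {gs : ℕ → ℕ → ℝ}
    {Z : ℕ → ℝ → ℝ} (ha0 : 0 < a) (ha1 : a < 1) (hθ : 0 < θ) (hθ1 : θ < 1) (hθΛ : θ ≤ Λ) (hb : 0 < b)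
    (h031 : ∀ K, Step.Discrete031 b β' K (g K) (gs K)) (hgs : ∀ K k, k ≤ K → 0 ≤ gs K k) (hR₁ : 0 ≤ R₁)
    (hC : 0 ≤ C) (hκ : 4 < κ₀) (hvol : 0 < vol) (hl₀ : 0 ≤ l₀)
    (hS0 : ∀ K, 0 ≤ S K) (hS : Summable S) (hPA : PeierlsDom l₀ T A Bad S) (hPB : PeierlsDom l₀ T B Bad S)
    (hZA : ∀ K t, |t| ≤ l₀ → Z K t = ∑ τ ∈ T K, A K t τ)
    (hZB : ∀ K t, |t| ≤ l₀ → Z (K + 1) t = ∑ τ ∈ T K, B K t τ)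
    (hA : ∀ K t, |t| ≤ l₀ → ∀ τ ∈ T K, 0 ≤ A K t τ) (hB : ∀ K t, |t| ≤ l₀ → ∀ τ ∈ T K, 0 ≤ B K t τ)
    (hpos : ∀ K t, |t| ≤ l₀ → 0 < ∑ τ ∈ T K, A K t τ)
    (hgood : ∀ K : ℕ, ∃ c : ℝ, ∀ t : ℝ, |t| ≤ l₀ → ∀ τ ∈ T K \ Bad K t,
      Real.exp (c - vol * crossoverDelta E a θ Λ R₁ C κ₀ gs 0 K) * A K t τ ≤ B K t τ ∧
        B K t τ ≤ Real.exp (c + vol * crossoverDelta E a θ Λ R₁ C κ₀ gs 0 K) * A K t τ) :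
    MatchingModConstants vol l₀ (crossoverDelta E a θ Λ R₁ C κ₀ gs (fun K => S K / vol)) Z ∧
    Summable (crossoverDelta E a θ Λ R₁ C κ₀ gs (fun K => S K / vol)) ∧
    (∀ t : ℝ, |t| ≤ l₀ → CauchySeq fun K => genFun Z K t) ∧
    TendstoUniformlyOn (fun K t => genFun Z K t) (genFunLim Z) Filter.atTop {t | |t| ≤ l₀} := by
  have h := cauchySum_of_crossover_relWeightBound (vol := vol) ha0 ha1 hθ hθ1 hθΛ hb h031 hgs hR₁ hC hκ hvol hl₀
    (relWeightBound_of_peierlsDom hS0 hS hA hB hPA hPB) hZA hZB hA hB hpos hgood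
  rw [weightSlot_fun_eq] at h
  exact h

end Shapes

/-! ## §4 A toy -/

/-- SANITY: two terms `{0, 1}` with weights `A 0 = 2x` (bad) and `A 1 = 2` (good), `x ≥ 0`; erase `0 ↦ 1`, one slot of
activity `x`, charge `{0}`: a Peierls domination with slot budget `x` — sharper than the gas toy `polymerDom_toy`
(budget `x e^{a}` under a KP condition).  Shows the shape is inhabited non-trivially. [folklore] -/
theorem peierlsDom_toy {x : ℝ} (hx : 0 ≤ x) (l₀ : ℝ) :
    PeierlsDom l₀ (fun _ => ({0, 1} : Finset ℕ)) (fun _ _ τ => if τ = 0 then 2 * x else 2)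
      (fun _ _ => ({0} : Finset ℕ)) (fun _ => x) where
  bad_subset K t _ := by simp
  dom K t _ := by
    refine ⟨1, fun _ => x, fun _ => 1, fun _ => {0}, fun _ => hx, by simp, ?_, ?_⟩
    · intro τ hτ
      refine ⟨by simp, Finset.singleton_nonempty _⟩
    · intro τ' hτ' Q
      have h1 : τ' = 1 := by
        simp only [Finset.mem_sdiff, Finset.mem_insert, Finset.mem_singleton] at hτ'
        omega
      subst h1
      by_cases hQ : Q = {0}
      · subst hQ
        have hset : (({0} : Finset ℕ).filter fun τ => (1 : ℕ) = 1 ∧ ({0} : Finset (Fin 1)) = {0}) = {0} := by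
          ext τ; simp
        rw [hset]
        simp
      · have hset : (({0} : Finset ℕ).filter fun τ => (1 : ℕ) = 1 ∧ ({0} : Finset (Fin 1)) = Q) = ∅ := by
          ext τ
          simp only [Finset.mem_filter, Finset.mem_singleton, true_and, Finset.notMem_empty, iff_false, not_and]
          intro _ h
          exact hQ h.symm
        rw [hset, Finset.sum_empty]
        have : (0 : ℝ) ≤ ∏ i ∈ Q, x := Finset.prod_nonneg fun _ _ => hx
        have h2 : (0 : ℝ) ≤ 2 := by norm_num
        simpa using mul_nonneg h2 this

end Literature.MathematicalPhysics.QuantumFieldTheory.Balaban1983to89.T4PeierlsDomination
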